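import Summits.SmoothPoincare4.SmoothPoincare4.Theorems.SullivanDualWitnessChargeHelperDiffeoOfProperInjective
import Summits.SmoothPoincare4.SmoothPoincare4.Theorems.SullivanDualWitnessChargeHelperCoveringHomeomorph
import Literature.Topology.FourManifolds.PuncturedHomotopySphere

/-!
# A proper immersion ℂ × ℂ → Σ∖p is injective (INJ)

Crux `WitnessCharge` (stmt-SmoothPoincare4-7824), line `Sketch`, skeleton v7, stub `helper_injectiveOfProper`.

Let `Σ` be a homotopy `4`-sphere, `p ∈ Σ`, and `Φ : ℂ × ℂ → Σ∖p` a `C^∞` map with everywhere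
injective differential which is proper (preimages of compact sets are compact). Then `Φ` is
injective — no positivity of intersections is needed.

Proof (covering spaces).
* By the dimension count and the inverse function theorem, `Φ` is a local diffeomorphism
  (`helper_diffeoOfProperInjective_isLocalDiffeomorph`, landed), hence a local homeomorphism
  (`IsLocalDiffeomorph.isLocalHomeomorph`).
* `Σ∖p = punctured p` is an open submanifold of the compact Hausdorff manifold `Σ`, so it is
  Hausdorff and locally compact (`ChartedSpace.locallyCompactSpace`); hence "preimages of compact
  sets are compact" upgrades to `IsProperMap Φ` (`isProperMap_iff_isCompact_preimage`).
* `Σ∖p` is simply connected (`HomotopySphere.simplyConnectedSpace_compl_singleton`, `n = 4 ≥ 3`,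
  Kosinski VI.2) and locally path connected (`ChartedSpace.locallyPathConnectedSpace`), and
  `ℂ × ℂ` is a nonempty connected Hausdorff space.
* A proper local homeomorphism from a nonempty connected Hausdorff space onto a simply connected,
  locally path connected Hausdorff space is a homeomorphism (`helper_coveringHomeomorph`,
  landed), in particular injective.

Everything here is proved; no facts and no definitions are introduced.
-/

noncomputable section

set_option linter.dupNamespace false

open scoped Manifold ContDiff Topology
open Set Filter Literature.Geometry.Kaehler Literature.Geometry.Symplectic
  Literature.Topology.FourManifolds

namespace Summit.SmoothPoincare4.SmoothPoincare4.Theorems.WitnessCharge.PencilIncompleteness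

/-- **A proper immersion `ℂ × ℂ → Σ∖p` is injective.** For a homotopy `4`-sphere `Σ` and
`p ∈ Σ`, a `C^∞` map `Φ : ℂ × ℂ → Σ∖p` with everywhere injective differential and compact
preimages of compact sets is injective: it is a proper local homeomorphism from the connected
`ℂ × ℂ` to the simply connected, locally path connected Hausdorff space `Σ∖p`, hence a
homeomorphism by the covering space argument `helper_coveringHomeomorph`. -/
theorem helper_injectiveOfProper :
    ∀ (S : HomotopySphere 4) (p : S.carrier) (Φ : ℂ × ℂ → punctured p),
      ContMDiff 𝓘(ℝ, ℂ × ℂ) (𝓡 4) ∞ Φ →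
      (∀ q : ℂ × ℂ, Function.Injective (mfderiv 𝓘(ℝ, ℂ × ℂ) (𝓡 4) Φ q)) →
      (∀ K : Set (punctured p), IsCompact K → IsCompact (Φ ⁻¹' K)) →
      Function.Injective Φ := by
  intro S p Φ hΦ hd hproper
  -- `Φ` is a local diffeomorphism, hence a local homeomorphism
  have hloc : IsLocalHomeomorph Φ :=
    (helper_diffeoOfProperInjective_isLocalDiffeomorph Φ hΦ hd).isLocalHomeomorph
  -- `Σ∖p` is locally compact Hausdorff, so `Φ` is a proper map
  haveI : LocallyCompactSpace (punctured p) :=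
    ChartedSpace.locallyCompactSpace (EuclideanSpace ℝ (Fin 4)) (punctured p)
  have hprop : IsProperMap Φ :=
    isProperMap_iff_isCompact_preimage.2 ⟨hΦ.continuous, fun K hK => hproper K hK⟩
  -- `Σ∖p` is simply connected (`4 ≥ 3`) and locally path connected
  haveI : SimplyConnectedSpace (punctured p) :=
    HomotopySphere.simplyConnectedSpace_compl_singleton S (by norm_num) p
  haveI : LocallyPathConnectedSpace (punctured p) :=
    ChartedSpace.locallyPathConnectedSpace (EuclideanSpace ℝ (Fin 4)) (punctured p)
  -- a proper local homeomorphism onto a simply connected space is a homeomorphism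
  exact (helper_coveringHomeomorph (ℂ × ℂ) (punctured p) Φ hprop hloc).injective

end Summit.SmoothPoincare4.SmoothPoincare4.Theorems.WitnessCharge.PencilIncompleteness
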